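import Literature.NumberTheory.Automorphic.RegularDiagonalCentralizer         -- ★ `eq_diagonal_of_mul_diagonal_eq_diagonal_mul`, `subgroup_le_glInt_of_isCompact_of_le_centralizer_diagonal`
import Literature.NumberTheory.Automorphic.CompactCoreCentralizerUnitary      -- ★ engine setting (§2 there), `apply_mem_centralizer_of_mem_centralizer`
import HarnessLib

/-!
# The split-torus translation of a regular diagonal centraliser: `Z_G(γ) = τ^ℤ · compactCore Z_G(γ)` through a closed embedding into `GL_N(E_w)`
(Tits (1979), §3.9 «`Z = A · Z_c`, `A ≅ ℤ^r` generated by a uniformiser of the split part»; Serre (1980), II.1.1; Rogawski (1990), §4.3 p. 43)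

Topic `NumberTheory/Automorphic`; namespace `Literature.NumberTheory.Automorphic`.  KERNEL mathematics only: theorems, no definition, no named fact, no instance,
no `sorry`.  Cell `pub/hodgecm-mathlib`, F0∕P3a, crux H413 = stmt-HodgeConjecture-24833, line «N6nsGerm», road (R2-ram) = RAMIFIED half of `stub_N6nsR2EP`
(census `F0/P3a/A-p06/g27/CENSUS-R2ram-RamifiedEulerPoincare.A-p06g27.md` §5 (S4b); LEAD F0P3a-plan (g10) T9-8 (B); seat A-p06 (g27)).  HONEST LABEL: HC_CM is
proved only modulo the 2 remaining named inputs (hLiu418, h413) until rung 0 closes; this file discharges no named fact.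

THE ENGINE behind the hypotheses `hgen` ∕ `hfree` of ★ (S4a) `classOrbitalIntegral_indicator_eq_mul_natCard_quotient_zpowers` («generalise-then-specialise»): a
topological group `G` closed-embedded by `φ` into `GL_N(E_w)`, an element `γ ∈ G` whose image is a REGULAR diagonal matrix (`dᵢ − dⱼ` units for `i ≠ j`), and
`τ ∈ Z_G(γ)`.
* §1 `valuation_apply_eq_one_of_mem_of_isCompact_of_le_centralizer_diagonal` — in `GL_N(E_w)`, the diagonal entries of the elements of a compact subgroup
  centralising a regular diagonal element are UNITS (★ `subgroup_le_glInt_of_isCompact_of_le_centralizer_diagonal`).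
* §2 `coe_apply_eq_diagonal_of_mem_centralizer`, `exists_monoidHom_valuation_apply` — `φ(Z_G(γ))` is diagonal, and `z ↦ |φ(z)ᵢᵢ|_w` is a homomorphism
  `Z_G(γ) → Γ_w`.
* §3 **`eq_zero_of_zpow_mem_compactCore_centralizer`** (free) — if some diagonal entry of `φ τ` is NOT a unit, `τ ^ n ∈ compactCore Z_G(γ) → n = 0`;
  **`exists_mul_zpow_inv_mem_compactCore_centralizer`** (gen) — if every `c ∈ Z_G(γ)` has `|φ(c)ᵢᵢ| = |φ(τ)ᵢᵢ|^n` for one `n = n(c) ∈ ℤ` and all `i`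
  (RANK ONE with generator `τ`), then `c · τ^{−n} ∈ compactCore Z_G(γ)` (it lies in the compact subgroup `φ⁻¹ GL_N(𝒪_w) ∩ Z_G(γ)`).
Consumer: (S4c) the non-split one-place model `U(σ_w, Φ₂)(E_w)` (`φ = subtype ∘ localNonsplitEquiv`, `γ = diag(t, σt⁻¹)` regular, `τ = diag(ϖ, σϖ⁻¹)`), then
★ (S4a) on the CM carrier for the `hN` binder of ★ `RankOneEulerPoincareGlue`.

## References
* [Tits1979] J. Tits, *Reductive groups over local fields*, PSPM 33.1 (1979), §3.9.
* [Serre1980Trees] J.-P. Serre, *Trees* (1980), II.1.1.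
* [Rogawski1990] J. D. Rogawski, *Automorphic Representations of Unitary Groups in Three Variables*, Ann. of Math. Stud. 123 (1990), §4.3 p. 43.
-/

set_option autoImplicit false

noncomputable section

open Matrix NumberField IsDedekindDomain Topology
open scoped MatrixGroups ValuativeRel
open ValuativeRel

namespace Literature.NumberTheory.Automorphic

/-! ## §1 `GL_N(E_w)`: diagonal entries of compact subgroups centralising a regular diagonal element are units -/

section GLLevel

open Literature.NumberTheory.GaloisRepresentations

variable {E : Type} [Field E] [NumberField E] (N : ℕ) (w : HeightOneSpectrum (𝓞 E))

/-- **Units on the diagonal**: if `C ≤ GL_N(E_w)` is a compact subgroup centralising the regular diagonal `γ = diag(d)` (`dᵢ − dⱼ` units, `i ≠ j`), every `c ∈ C`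
has `|cᵢᵢ|_w = 1` (`C ≤ GL_N(𝒪_w)` by ★ `subgroup_le_glInt_of_isCompact_of_le_centralizer_diagonal`, `c` and `c⁻¹` are diagonal with integral entries and
`cᵢᵢ · (c⁻¹)ᵢᵢ = 1`). [cite: Tits1979, §3.9] [cite: Rogawski1990, §4.3 p. 43] -/
theorem valuation_apply_eq_one_of_mem_of_isCompact_of_le_centralizer_diagonal {γ : GL (Fin N) (w.adicCompletion E)} {d : Fin N → w.adicCompletion E}
    (hγ : (γ : Matrix (Fin N) (Fin N) (w.adicCompletion E)) = diagonal d) (hd : ∀ i j, i ≠ j → IsUnit (d i - d j))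
    (C : Subgroup (GL (Fin N) (w.adicCompletion E))) (hC : IsCompact (C : Set (GL (Fin N) (w.adicCompletion E))))
    (hCZ : C ≤ Subgroup.centralizer ({γ} : Set (GL (Fin N) (w.adicCompletion E)))) {c : GL (Fin N) (w.adicCompletion E)} (hc : c ∈ C) (i : Fin N) :
    valuation (w.adicCompletion E) ((c : Matrix (Fin N) (Fin N) (w.adicCompletion E)) i i) = 1 := by
  have hint := (mem_glInt_iff c).1 (subgroup_le_glInt_of_isCompact_of_le_centralizer_diagonal N w hγ hd C hC hCZ hc)
  -- `c` is diagonal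
  have hcd : (c : Matrix (Fin N) (Fin N) (w.adicCompletion E)) = diagonal fun k => (c : Matrix (Fin N) (Fin N) (w.adicCompletion E)) k k := by
    have h1 : c * γ = γ * c := Subgroup.mem_centralizer_singleton_iff.1 (hCZ hc)
    have h2 : (c : Matrix (Fin N) (Fin N) (w.adicCompletion E)) * diagonal d = diagonal d * (c : Matrix (Fin N) (Fin N) (w.adicCompletion E)) := by
      rw [← hγ, ← Units.val_mul, ← Units.val_mul, h1]
    exact eq_diagonal_of_mul_diagonal_eq_diagonal_mul h2 hd
  -- `cᵢᵢ · (c⁻¹)ᵢᵢ = 1`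
  have hprod : (c : Matrix (Fin N) (Fin N) (w.adicCompletion E)) i i * ((c⁻¹ : GL (Fin N) (w.adicCompletion E)) : Matrix (Fin N) (Fin N) (w.adicCompletion E)) i i = 1 := by
    have h1 : (c : Matrix (Fin N) (Fin N) (w.adicCompletion E)) * ((c⁻¹ : GL (Fin N) (w.adicCompletion E)) : Matrix (Fin N) (Fin N) (w.adicCompletion E)) = 1 := by
      rw [← Units.val_mul, mul_inv_cancel, Units.val_one]
    have h2 := congrFun (congrFun h1 i) i
    rw [hcd, diagonal_mul, Matrix.one_apply_eq] at h2
    exact h2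
  have hle₁ : valuation (w.adicCompletion E) ((c : Matrix (Fin N) (Fin N) (w.adicCompletion E)) i i) ≤ 1 := (Valuation.mem_integer_iff _ _).1 (hint.1 i i)
  have hle₂ : valuation (w.adicCompletion E) (((c⁻¹ : GL (Fin N) (w.adicCompletion E)) : Matrix (Fin N) (Fin N) (w.adicCompletion E)) i i) ≤ 1 :=
    (Valuation.mem_integer_iff _ _).1 (hint.2 i i)
  have hmul : valuation (w.adicCompletion E) ((c : Matrix (Fin N) (Fin N) (w.adicCompletion E)) i i) *
      valuation (w.adicCompletion E) (((c⁻¹ : GL (Fin N) (w.adicCompletion E)) : Matrix (Fin N) (Fin N) (w.adicCompletion E)) i i) = 1 := by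
    rw [← map_mul, hprod, map_one]
  refine le_antisymm hle₁ ?_
  calc (1 : ValueGroupWithZero (w.adicCompletion E)) = _ := hmul.symm
    _ ≤ valuation (w.adicCompletion E) ((c : Matrix (Fin N) (Fin N) (w.adicCompletion E)) i i) * 1 := mul_le_mul_right hle₂ _
    _ = _ := mul_one _

end GLLevel

/-! ## §2 The engine: `φ(Z_G(γ))` is diagonal; the valuation of a diagonal entry is a homomorphism -/

section Engine

open Literature.NumberTheory.GaloisRepresentations

variable {E : Type} [Field E] [NumberField E] (w : HeightOneSpectrum (𝓞 E)) {N : ℕ}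
  {G : Type*} [Group G] (φ : G →* GL (Fin N) (w.adicCompletion E)) {γ : G} {d : Fin N → w.adicCompletion E}
  (hγ : ((φ γ : GL (Fin N) (w.adicCompletion E)) : Matrix (Fin N) (Fin N) (w.adicCompletion E)) = diagonal d) (hd : ∀ i j, i ≠ j → IsUnit (d i - d j))

include hγ hd in
/-- `φ` maps the centraliser of `γ` into DIAGONAL matrices (★ `eq_diagonal_of_mul_diagonal_eq_diagonal_mul`). [cite: Rogawski1990, §3.6 p. 31] [cite: Tits1979, §3.9] -/
theorem coe_apply_eq_diagonal_of_mem_centralizer {z : G} (hz : z ∈ Subgroup.centralizer ({γ} : Set G)) :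
    ((φ z : GL (Fin N) (w.adicCompletion E)) : Matrix (Fin N) (Fin N) (w.adicCompletion E)) =
      diagonal fun i => ((φ z : GL (Fin N) (w.adicCompletion E)) : Matrix (Fin N) (Fin N) (w.adicCompletion E)) i i := by
  have h1 : φ z * φ γ = φ γ * φ z := Subgroup.mem_centralizer_singleton_iff.1 (apply_mem_centralizer_of_mem_centralizer φ γ hz)
  have h2 : ((φ z : GL (Fin N) (w.adicCompletion E)) : Matrix (Fin N) (Fin N) (w.adicCompletion E)) * diagonal d =
      diagonal d * ((φ z : GL (Fin N) (w.adicCompletion E)) : Matrix (Fin N) (Fin N) (w.adicCompletion E)) := by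
    rw [← hγ, ← Units.val_mul, ← Units.val_mul, h1]
  exact eq_diagonal_of_mul_diagonal_eq_diagonal_mul h2 hd

include hγ hd in
/-- On the centraliser the `i`-th diagonal entry of `φ` is MULTIPLICATIVE. [cite: Tits1979, §3.9] -/
theorem apply_coe_mul_apply_eq (z z' : Subgroup.centralizer ({γ} : Set G)) (i : Fin N) :
    ((φ ((z * z' : Subgroup.centralizer ({γ} : Set G)) : G) : GL (Fin N) (w.adicCompletion E)) : Matrix (Fin N) (Fin N) (w.adicCompletion E)) i i =
      ((φ (z : G) : GL (Fin N) (w.adicCompletion E)) : Matrix (Fin N) (Fin N) (w.adicCompletion E)) i i *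
        ((φ (z' : G) : GL (Fin N) (w.adicCompletion E)) : Matrix (Fin N) (Fin N) (w.adicCompletion E)) i i := by
  have hz' := coe_apply_eq_diagonal_of_mem_centralizer w φ hγ hd z'.2
  rw [Subgroup.coe_mul, map_mul, Units.val_mul]
  conv_lhs => rw [hz', mul_diagonal]

include hγ hd in
/-- **The valuation of a diagonal entry is a homomorphism `Z_G(γ) → Γ_w`** (existence form — no definition is introduced). [cite: Tits1979, §3.9] -/
theorem exists_monoidHom_valuation_apply (i : Fin N) :
    ∃ ψ : Subgroup.centralizer ({γ} : Set G) →* ValueGroupWithZero (w.adicCompletion E),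
      ∀ z : Subgroup.centralizer ({γ} : Set G),
        ψ z = valuation (w.adicCompletion E) (((φ (z : G) : GL (Fin N) (w.adicCompletion E)) : Matrix (Fin N) (Fin N) (w.adicCompletion E)) i i) :=
  ⟨{ toFun := fun z => valuation (w.adicCompletion E) (((φ (z : G) : GL (Fin N) (w.adicCompletion E)) : Matrix (Fin N) (Fin N) (w.adicCompletion E)) i i)
     map_one' := by simp only [Subgroup.coe_one, map_one, Units.val_one, one_apply_eq]
     map_mul' := fun z z' => by simp only [apply_coe_mul_apply_eq w φ hγ hd, map_mul] }, fun _ => rfl⟩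

include hγ hd in
/-- `|φ(τ ^ n)ᵢᵢ| = |φ(τ)ᵢᵢ| ^ n` for `τ ∈ Z_G(γ)`, `n ∈ ℤ`. [cite: Tits1979, §3.9] -/
theorem valuation_apply_coe_zpow (τ : Subgroup.centralizer ({γ} : Set G)) (n : ℤ) (i : Fin N) :
    valuation (w.adicCompletion E) (((φ ((τ ^ n : Subgroup.centralizer ({γ} : Set G)) : G) : GL (Fin N) (w.adicCompletion E)) : Matrix (Fin N) (Fin N) (w.adicCompletion E)) i i) =
      valuation (w.adicCompletion E) (((φ (τ : G) : GL (Fin N) (w.adicCompletion E)) : Matrix (Fin N) (Fin N) (w.adicCompletion E)) i i) ^ n := by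
  obtain ⟨ψ, hψ⟩ := exists_monoidHom_valuation_apply w φ hγ hd i
  rw [← hψ, ← hψ, map_zpow]

include hγ hd in
/-- `|φ(z)ᵢᵢ| ≠ 0` on the centraliser (the image of a group element under a homomorphism to `Γ_w` is a unit). [cite: Tits1979, §3.9] -/
theorem valuation_apply_coe_ne_zero (z : Subgroup.centralizer ({γ} : Set G)) (i : Fin N) :
    valuation (w.adicCompletion E) (((φ (z : G) : GL (Fin N) (w.adicCompletion E)) : Matrix (Fin N) (Fin N) (w.adicCompletion E)) i i) ≠ 0 := by
  obtain ⟨ψ, hψ⟩ := exists_monoidHom_valuation_apply w φ hγ hd i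
  rw [← hψ]
  exact ((Group.isUnit z).map ψ).ne_zero

/-! ## §3 (free) and (gen) -/

variable [TopologicalSpace G]

include hγ hd in
/-- **(free) `τ ^ n ∈ compactCore Z_G(γ) → n = 0`** when `φ` is a closed embedding and some diagonal entry of `φ τ` is not a unit: a compact subgroup of `Z_G(γ)`
containing `τ ^ n` maps to a compact subgroup of `GL_N(E_w)` centralising `φ γ`, whose diagonal entries are units (§1), so `|φ(τ)ᵢᵢ| ^ n = 1`.
[cite: Tits1979, §3.9] [cite: Serre1980Trees, II.1.1] -/
theorem eq_zero_of_zpow_mem_compactCore_centralizer (hφ : IsClosedEmbedding φ) (τ : Subgroup.centralizer ({γ} : Set G)) {i : Fin N}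
    (hτ : valuation (w.adicCompletion E) (((φ (τ : G) : GL (Fin N) (w.adicCompletion E)) : Matrix (Fin N) (Fin N) (w.adicCompletion E)) i i) ≠ 1)
    (n : ℤ) (hn : τ ^ n ∈ compactCore (Subgroup.centralizer ({γ} : Set G))) : n = 0 := by
  obtain ⟨Kc, hKc, hmem⟩ := (mem_compactCore_iff _).1 hn
  have hCc : IsCompact (((Kc.map (Subgroup.centralizer ({γ} : Set G)).subtype).map φ : Subgroup (GL (Fin N) (w.adicCompletion E))) :
      Set (GL (Fin N) (w.adicCompletion E))) := by
    rw [Subgroup.coe_map, Subgroup.coe_map]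
    exact (hKc.image continuous_subtype_val).image hφ.continuous
  have hCZ : ((Kc.map (Subgroup.centralizer ({γ} : Set G)).subtype).map φ : Subgroup (GL (Fin N) (w.adicCompletion E))) ≤
      Subgroup.centralizer ({φ γ} : Set (GL (Fin N) (w.adicCompletion E))) := by
    rintro _ ⟨_, ⟨z, -, rfl⟩, rfl⟩
    exact apply_mem_centralizer_of_mem_centralizer φ γ z.2
  have hval := valuation_apply_eq_one_of_mem_of_isCompact_of_le_centralizer_diagonal N w hγ hd _ hCc hCZ
    (c := φ ((τ ^ n : Subgroup.centralizer ({γ} : Set G)) : G)) ⟨_, ⟨τ ^ n, hmem, rfl⟩, rfl⟩ i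
  rw [valuation_apply_coe_zpow w φ hγ hd] at hval
  exact (zpow_eq_one_iff_right₀ zero_le hτ).1 hval

variable [IsTopologicalGroup G]

include hγ hd in
/-- **(gen) `c · τ^{−n} ∈ compactCore Z_G(γ)`** when `φ` is a closed embedding and `Z_G(γ)` has RANK ONE WITH GENERATOR `τ` in valuation: every `c ∈ Z_G(γ)` admits
`n ∈ ℤ` with `|φ(c)ᵢᵢ| = |φ(τ)ᵢᵢ| ^ n` for all `i`; then `φ(c · τ^{−n})` and its inverse are diagonal with unit entries, i.e. `c · τ^{−n}` lies in the COMPACT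
subgroup `φ⁻¹ GL_N(𝒪_w) ∩ Z_G(γ)`. [cite: Tits1979, §3.9] [cite: Serre1980Trees, II.1.1] [cite: Rogawski1990, §4.3 p. 43] -/
theorem exists_mul_zpow_inv_mem_compactCore_centralizer (hφ : IsClosedEmbedding φ) (τ : Subgroup.centralizer ({γ} : Set G))
    (hrank : ∀ c : Subgroup.centralizer ({γ} : Set G), ∃ n : ℤ, ∀ i : Fin N,
      valuation (w.adicCompletion E) (((φ (c : G) : GL (Fin N) (w.adicCompletion E)) : Matrix (Fin N) (Fin N) (w.adicCompletion E)) i i) =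
        valuation (w.adicCompletion E) (((φ (τ : G) : GL (Fin N) (w.adicCompletion E)) : Matrix (Fin N) (Fin N) (w.adicCompletion E)) i i) ^ n)
    (c : Subgroup.centralizer ({γ} : Set G)) : ∃ n : ℤ, c * (τ ^ n)⁻¹ ∈ compactCore (Subgroup.centralizer ({γ} : Set G)) := by
  haveI : T2Space G := hφ.isEmbedding.t2Space
  -- the compact subgroup `φ⁻¹ GL_N(𝒪_w) ∩ Z_G(γ)`
  have hce : IsClosedEmbedding (φ.comp (Subgroup.centralizer ({γ} : Set G)).subtype) :=
    hφ.comp (Set.isClosed_centralizer _).isClosedEmbedding_subtypeVal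
  have hKint : IsCompact (((glInt N (w.adicCompletion E)).comap (φ.comp (Subgroup.centralizer ({γ} : Set G)).subtype) :
      Subgroup (Subgroup.centralizer ({γ} : Set G))) : Set (Subgroup.centralizer ({γ} : Set G))) := by
    rw [Subgroup.coe_comap]
    exact hce.isCompact_preimage (isCompact_glInt N (w.adicCompletion E))
  -- integrality from unit diagonal entries
  have key : ∀ z : Subgroup.centralizer ({γ} : Set G),
      (∀ i, valuation (w.adicCompletion E) (((φ (z : G) : GL (Fin N) (w.adicCompletion E)) : Matrix (Fin N) (Fin N) (w.adicCompletion E)) i i) = 1) →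
      ∀ i j, ((φ (z : G) : GL (Fin N) (w.adicCompletion E)) : Matrix (Fin N) (Fin N) (w.adicCompletion E)) i j ∈ 𝒪[w.adicCompletion E] := by
    intro z hz i j
    by_cases hij : i = j
    · subst hij
      exact (Valuation.mem_integer_iff _ _).2 (hz i).le
    · rw [coe_apply_eq_diagonal_of_mem_centralizer w φ hγ hd z.2, diagonal_apply_ne _ hij]
      exact zero_mem _
  obtain ⟨n, hn⟩ := hrank c
  have h0 := valuation_apply_coe_ne_zero w φ hγ hd τ
  have hz : ∀ i, valuation (w.adicCompletion E)
      (((φ ((c * (τ ^ n)⁻¹ : Subgroup.centralizer ({γ} : Set G)) : G) : GL (Fin N) (w.adicCompletion E)) : Matrix (Fin N) (Fin N) (w.adicCompletion E)) i i) = 1 := by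
    intro i
    obtain ⟨ψ, hψ⟩ := exists_monoidHom_valuation_apply w φ hγ hd i
    have hci := hn i
    have h0' : ψ τ ≠ 0 := by rw [hψ]; exact h0 i
    rw [← hψ, ← hψ] at hci
    rw [← hψ, map_mul, map_inv, map_zpow, hci, mul_inv_cancel₀ (zpow_ne_zero n h0')]
  have hz' : ∀ i, valuation (w.adicCompletion E)
      (((φ (((c * (τ ^ n)⁻¹)⁻¹ : Subgroup.centralizer ({γ} : Set G)) : G) : GL (Fin N) (w.adicCompletion E)) : Matrix (Fin N) (Fin N) (w.adicCompletion E)) i i) = 1 := by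
    intro i
    obtain ⟨ψ, hψ⟩ := exists_monoidHom_valuation_apply w φ hγ hd i
    have h1 := hz i
    rw [← hψ] at h1 ⊢
    rw [map_inv, h1, inv_one]
  have hmemK : c * (τ ^ n)⁻¹ ∈ ((glInt N (w.adicCompletion E)).comap (φ.comp (Subgroup.centralizer ({γ} : Set G)).subtype) :
      Subgroup (Subgroup.centralizer ({γ} : Set G))) := by
    rw [Subgroup.mem_comap, MonoidHom.comp_apply, Subgroup.subtype_apply, mem_glInt_iff]
    refine ⟨key _ hz, fun i j => ?_⟩
    have h := key _ hz' i j
    rwa [Subgroup.coe_inv, map_inv] at h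
  exact ⟨n, subset_compactCore_of_isCompact hKint hmemK⟩

end Engine

end Literature.NumberTheory.Automorphic

end
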